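import Summits.BirchSwinnertonDyer.Rank1Residual.GaloisImage.VisibleIndexBudgetRecords6
import Summits.BirchSwinnertonDyer.Rank1Residual.GaloisImage.VisThreeESideInstancesIdx27B
import Summits.BirchSwinnertonDyer.Rank1Residual.GaloisImage.VisibleIndexBudgetRecords7
import Summits.BirchSwinnertonDyer.Rank1Residual.GaloisImage.VisibleIndexBudgetRecords8
import Summits.BirchSwinnertonDyer.Rank1Residual.GaloisImage.VisThreeESideInstancesIdx27C
import Summits.BirchSwinnertonDyer.Rank1Residual.Additive.X4RankZeroVisibleLowerBoundPlacesSix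
import Summits.BirchSwinnertonDyer.Rank1Residual.Additive.IntModelTamagawaCertificateLocal
import Summits.BirchSwinnertonDyer.Rank1Residual.Additive.IntModelTamagawaCertificate
import Summits.BirchSwinnertonDyer.Rank1Residual.Additive.JValuationOfIntModel
import Summits.BirchSwinnertonDyer.Rank1Residual.Additive.X4ThreeResCertKernel
import Summits.BirchSwinnertonDyer.Rank1Residual.GaloisImage.ThreeCongruenceHesseCertificateLemmas
import Literature.NumberTheory.EllipticCurves.Fisher2012.HesseFamilyThreeReverseProofs
import HarnessLib

/-!
# T-IDX27-BSDP (FILE 4): θ-FREE, RANK-FREE `BSD(E,3)` RECORDS for the PASS-rank3 rows `273096e1`, `287775i1`, `293184cj1`, `337896u1`, `409275bk1`, `416448db1`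
# (team n1011, seat p17 lineage; the BSDp twins of the hvis-currency kernel instances of FILES D15 / T-IDX27-REC)

HONEST FRAMING (cell `b2b-bsdres`, run/shared/lean/b2b/bsd-rank1-residual/, verbatim in every
file): the goal of the cell is to DELETE the COMBINATION-SHAPED residual classes of the
Birch–Swinnerton-Dyer formula for ALL analytic-rank `≤ 1` elliptic curves over `ℚ` — "full BSD
formula for every rank `≤ 1` curve in class `C`" assembled STRICTLY from published theorems — so
that the rank-`≤ 1` remainder becomes exactly the CONSTRUCTION-SHAPED classes, which are TYPED
(missing-input `Prop`s), NOT attempted. This is not "finishing BSD". Team n1011 (N11 = X4 ∧ `p = 3`),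
research route on the CONSTRUCTION-SHAPED class X4; per-row RECORDS = CERTIFICATE-EVIDENCE that close
NOTHING beyond their displayed binders and move no mark / label / count; nothing booked; theorems only
(no definition, no named fact, no `sorry`). CONDITIONAL on exactly the named inputs displayed as
hypotheses: on (M) rows the seven UPPER-half facts of the (M)-END (Kato 14.5 (3) with the local
Tamagawa term / Delbourgo Prop. 4 / Gross–Zagier–Kolyvagin / modularity ×2 / Kato's half eigen-ideal
(Wuthrich) / Cassels–Tate); on (G) rows Kato 14.5 (3), Cassels–Tate, Gross–Zagier–Kolyvagin,
modularity, plus a parametrisation datum `D` with `3 ∤ c_D` (Manin) displayed.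

## What

For each PASS-rank3 row `E ~ E′` of r1's `route1/g29_cvis_pairs.tsv` below (`E` X4 at `3`, `r_an = 0`,
`ord₃ #Ш_an = 2`; `E′` a `3`-congruent Cremona rank-3 partner), `bsdp3_idx_v<E> : BSDp W 3` for any
globally minimal `W` with Cremona's integral model, over n1011-p14's hvis-currency ENDs
`X4RankZero.bsdp_three_potMult_of_exists_sha_three_torsion` ((M) rows) /
`X4RankZero.bsdp_of_exists_sha_torsion_of_kato` ((G) rows) fed by n1011-p17's KERNEL INSTANCE
`exists_sha_three_torsion_<E>` (FILES D15 `GaloisImage/VisibleIndexBudgetPilot.lean` /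
T-IDX27-REC `GaloisImage/VisibleIndexBudgetRecords<k>.lean`: `27 ≤ [E′(ℚ):3E′(ℚ)]` from three points,
ten chords and thirteen NO-prime certificates; T-LOC3L certificates at the free places; D14 at `3`;
budget `3·3 < 27`) — so NO rank statement about `E′` is displayed — with the `3`-congruence
`θ : E′[3] ≃ E[3]` DISCHARGED IN THE KERNEL by n1011-p07's literal-equation lemma
`VisCerts.torsionIso3_of_hesseCert_mk` / `…_of_dualHesseCert_mk` (A243 = the tree theorem
`Fisher2012.thm132rev_threeCongruent_dualHessePencil_holds`) with p07's certificate `(l : m), u` from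
`HOME/b2b-bsdres-n1011-p07/g10/certs999/certs_all18422.tsv` (verified in exact arithmetic by this seat,
`HOME/b2b-bsdres-n1011-p17/gen10/`), E-side `ρ̄_{E,3}` onto (+ tower, + `3 ∤ ∏ c_ℓ` by a TamLocal ROW
certificate on (G) rows) from `GaloisImage/VisThreeESideInstancesIdx27{A,B,C}.lean` / `…Instances7.lean`,
X4 / `Addv` and the sign of `ord₃ j` from the integer model (`addv_of_intModel`,
`padicValRat_j_{neg,nonneg}_of_intModel`), `E(ℚ)` finite (`finite_point_of_analyticRank_eq_zero`, `hGZK`)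
and `3 ∤ #E(ℚ)` (`coprime_natCard_point_of_irr`). DISPLAYED per record = the named facts, `hr`
(`r_an = 0`), `hq`/`hv` (`ord₃ #Ш_an ≤ 2`; Cremona: `= 2` on every row), (G): `D`, `hc` — and NOTHING ELSE
(no `θ`, no `hrank`, no local binder).

Rows in this file: `273096e1 ~ 273096a1` (M); `287775i1 ~ 287775a1` (G-ss); `293184cj1 ~ 293184c1` (M); `337896u1 ~ 37544c1` (G-ord); `409275bk1 ~ 409275c1` (M); `416448db1 ~ 416448o1` (G-ss).

References: [CremonaMazur2000] §3, Table 1; [AgasheStein2002] Thm. 3.1; [Delbourgo1998] Prop. 4;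
[Kato2004Asterisque] Thm. 14.5; [Fisher2012Hessian] Thm. 13.2, §13; [SilvermanAEC2009] VII.5.1, X.4.2, X.4.14;
[SilvermanATAEC1994] IV.9.4; [Serre1972] §2.4; [Cremona2006] (labels as named per record).
-/

set_option autoImplicit false

noncomputable section

open scoped Classical

open WeierstrassCurve NumberField IsDedekindDomain Rat.HeightOneSpectrum
  Literature.NumberTheory.EllipticCurves Literature.NumberTheory.EllipticCurves.ModularForms
  Literature.NumberTheory.EllipticCurves.Rank1Residual
  Literature.NumberTheory.EllipticCurves.Rank1Residual.Typed
  Literature.NumberTheory.GaloisRepresentations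
  Summit.BirchSwinnertonDyer.BirchSwinnertonDyer.Rank1Residual.IntModel
  Summit.BirchSwinnertonDyer.BirchSwinnertonDyer.Rank2Observatory
  Summit.BirchSwinnertonDyer.BirchSwinnertonDyer.Rank2Observatory.Tam
  Summit.BirchSwinnertonDyer.Rank1Residual.GaloisImage
  Summit.BirchSwinnertonDyer.Rank1Residual.GaloisImage.DivisionDecider

namespace Summit.BirchSwinnertonDyer.Rank1Residual.Additive

/-- **T-IDX27-BSDP RECORD (CLOSES NOTHING beyond its displayed binders; moves no mark): `BSD(E,3)` for the PASS-rank3 row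
`273096e1 = [0, 0, 0, -11703, -486070]`** (X4 at `3`, additive potentially multiplicative (`ord₃ j < 0`); `r_an = 0`, `ord₃ #Ш_an = 2`) from its `3`-congruent rank-3 partner
`273096a1 = [0, 0, 0, -36, 260]` — θ-FREE and RANK-FREE: the visible element is n1011-p17's kernel instance `exists_sha_three_torsion_273096e1`
(index certificate `27 ≤ [E′(ℚ):3E′(ℚ)]`, local certificates, D14 at `3`), the `3`-congruence `θ` is DISCHARGED IN THE
KERNEL by n1011-p07's `VisCerts.torsionIso3_of_hesseCert_mk` with the Hesse certificate `(l : m) = (-780 : 1)`, `u = 648`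
(`certs_all18422.tsv`), `ρ̄_{E,3}` onto by `GaloisImage.surj3_frob_v273096e1`, `E(ℚ)` finite with `3 ∤ #E(ℚ)` from `r_an = 0`
(`hGZK`) and irreducibility. END = n1011-p14's `X4RankZero.bsdp_three_potMult_of_exists_sha_three_torsion` BY NAME. DISPLAYED = the named facts of the
END, `hr`, `hq`/`hv` — EVIDENCE columns, not booked. [cite: CremonaMazur2000, §3 and Table 1]
[cite: SilvermanAEC2009, Thm. X.4.2 (a) and X.4.14] [cite: Fisher2012Hessian, Thm. 13.2 (n = 3)] [cite: Cremona2006, Table 1 (labels 273096e1, 273096a1)] -/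
theorem bsdp3_idx_v273096e1
    (hKatoS : Kato2004.rankZero_padicValNat_sha_le_sub_localTamagawa_of_additive_potGood_of_imageContainsSL2)
    (hDel : Delbourgo1998.prop4_rankZero_pow_dvd_constantCoeff)
    (hGZK : rank_eq_analyticRank_of_analyticRank_le_one) (hmod : hasEntireLFunction_rat)
    (hmodD : nonempty_modularParametrizationData)
    (hKatoχ : Wuthrich2014.kato_halfEigenCharIdeal_dvd_cyclotomicPrime_of_surjective)
    (hCT : exists_casselsTate_pairing (K := ℚ))
    (W : WeierstrassCurve ℚ) [W.IsElliptic] [W.IsGloballyMinimal]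
    (hI : integralModelInt W = ⟨0, 0, 0, -11703, -486070⟩)
    (hr : W.analyticRank = 0) {q : ℚ} (hq : shaAn W = (q : ℂ)) (hv : padicValRat 3 q ≤ 2)
    (W' : WeierstrassCurve ℚ) (hW' : W' = ⟨0, 0, 0, -36, 260⟩) [W'.IsElliptic] :
    haveI : Fact (Nat.Prime 3) := ⟨Nat.prime_three⟩
    BSDp W 3 := by
  haveI : Fact (Nat.Prime 3) := ⟨Nat.prime_three⟩
  -- the row: surj(3), X4 at `3`, sign of `ord₃ j`, the literal model
  have hsurj : W.HasSurjectiveModNGaloisRep 3 := GaloisImage.surj3_frob_v273096e1 hI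
  have hirr : Irr W 3 := hasIrreducibleModPGaloisRep_of_hasSurjectiveModNGaloisRep W 3 hsurj
  have hX : ClassX4 W 3 := ⟨by norm_num, addv_of_intModel hI 3 (by decide) (by decide), hirr⟩
  have hj : padicValRat 3 W.j < 0 :=
    padicValRat_j_neg_of_intModel hI (p := 3) 2 (by decide) (by decide)
  have hE : (⟨0, 0, 0, -11703, -486070⟩ : WeierstrassCurve ℤ).map (Int.castRingHom ℚ) = W := by
    rw [IntModelTam.eq_baseChange_of_integralModelInt hI]; rfl
  have hW : W = ⟨0, 0, 0, -11703, -486070⟩ := by rw [← hE]; ext <;> simp [WeierstrassCurve.map]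
  -- θ : E′[3] ≃ E[3] IN THE KERNEL — n1011-p07's Hesse certificate through p07's literal-equation lemma BY NAME
  obtain ⟨θ, hθ⟩ : X1.CongruenceTransfer.TorsionIso W' W 3 :=
    VisCerts.torsionIso3_of_hesseCert_mk hW hW' 561744 419964480 1728 (-224640)
      (by norm_num) (by norm_num) (by norm_num) (by norm_num) (-780) 1 648 (by norm_num)
      (by norm_num) (by norm_num)
  -- `E(ℚ)` finite and `3 ∤ #E(ℚ)` (r_an = 0, `E[3]` irreducible), then the visible element from the kernel instance
  haveI hfin : Finite W.toAffine.Point := finite_point_of_analyticRank_eq_zero W hGZK hr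
  have hvis := exists_sha_three_torsion_273096e1 W W' hW hW' θ hθ hfin (coprime_natCard_point_of_irr W 3 hirr)
  exact X4RankZero.bsdp_three_potMult_of_exists_sha_three_torsion hKatoS hDel hGZK hmod hmodD hKatoχ hCT W
    hr hX hsurj hj hq hv hvis

/-- E-side Tamagawa ROW certificate of `287775i1 = [1, -1, 0, -9867, -374584]` (one local certificate per bad prime, Tate's algorithm — n1011-p18's `eside_tamrow` over the observatory's `tate_deep.py`, unchanged;
`3`: additive `III`, `c = 2` (Step-2 Tate certificate); `5`: additive `III*`, `c = 2` (deep Tate certificate); `1279`: non-split `I1`, `c = 1`): the certified value set of `∏ c_ℓ` avoids `3`. [cite: SilvermanATAEC1994, IV.9.4] -/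
theorem tamRow_idx_v287775i1 :
    TamLocal.rowCheck [⟨3, 1, 4, 0, 1, 0, 1, 3, 3, 2, 2⟩, ⟨5, 2, 5, 0, 19, 2, 53, 9, 9, 0, 2⟩, ⟨1279, 35, 3, 0, 0, 0, 0, 1, 0, 0, 1⟩] ⟨1, -1, 0, -9867, -374584⟩ = true := by
  decide +kernel

/-- **T-IDX27-BSDP RECORD (CLOSES NOTHING beyond its displayed binders; moves no mark): `BSD(E,3)` for the PASS-rank3 row
`287775i1 = [1, -1, 0, -9867, -374584]`** (X4 at `3`, additive potentially good (`0 ≤ ord₃ j`; G-ss; `3 ∤ ∏ c_ℓ`); `r_an = 0`, `ord₃ #Ш_an = 2`) from its `3`-congruent rank-3 partner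
`287775a1 = [0, 0, 1, 45, 506]` — θ-FREE and RANK-FREE: the visible element is n1011-p17's kernel instance `exists_sha_three_torsion_287775i1`
(index certificate `27 ≤ [E′(ℚ):3E′(ℚ)]`, local certificates, D14 at `3`), the `3`-congruence `θ` is DISCHARGED IN THE
KERNEL by n1011-p07's `VisCerts.torsionIso3_of_hesseCert_mk` with the Hesse certificate `(l : m) = (-675 : 1)`, `u = 300`
(`certs_all18422.tsv`), `ρ̄_{E,3}` onto by `GaloisImage.surj3_frob_v287775i1` and the `3`-adic tower by `GaloisImage.towerSurj3u_frob_v287775i1`, `3 ∤ ∏ c_ℓ` by the Tamagawa row certificate `tamRow_idx_v287775i1`, `E(ℚ)` finite with `3 ∤ #E(ℚ)` from `r_an = 0`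
(`hGZK`) and irreducibility. END = n1011-p14's `X4RankZero.bsdp_of_exists_sha_torsion_of_kato` BY NAME. DISPLAYED = the named facts of the
END, `hr`, `hq`/`hv`, `D`/`hc` (Manin datum) — EVIDENCE columns, not booked. [cite: CremonaMazur2000, §3 and Table 1]
[cite: SilvermanAEC2009, Thm. X.4.2 (a) and X.4.14] [cite: Fisher2012Hessian, Thm. 13.2 (n = 3)] [cite: Cremona2006, Table 1 (labels 287775i1, 287775a1)] -/
theorem bsdp3_idx_v287775i1
    (hKato : Kato2004.rankZero_padicValNat_sha_le_of_additive_potGood_of_imageContainsSL2)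
    (hCT : exists_casselsTate_pairing (K := ℚ))
    (hGZK : rank_eq_analyticRank_of_analyticRank_le_one) (hmod : hasEntireLFunction_rat)
    (W : WeierstrassCurve ℚ) [W.IsElliptic] [W.IsGloballyMinimal]
    (hI : integralModelInt W = ⟨1, -1, 0, -9867, -374584⟩)
    (hr : W.analyticRank = 0)
    {N : ℕ} [NeZero N] (D : ModularParametrizationData W N) (hc : ¬ ((3 : ℕ) : ℤ) ∣ D.maninConstant)
    {q : ℚ} (hq : shaAn W = (q : ℂ)) (hv : padicValRat 3 q ≤ 2)
    (W' : WeierstrassCurve ℚ) (hW' : W' = ⟨0, 0, 1, 45, 506⟩) [W'.IsElliptic] :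
    haveI : Fact (Nat.Prime 3) := ⟨Nat.prime_three⟩
    BSDp W 3 := by
  haveI : Fact (Nat.Prime 3) := ⟨Nat.prime_three⟩
  -- the row: surj(3), X4 at `3`, sign of `ord₃ j`, the literal model
  have hsurj : W.HasSurjectiveModNGaloisRep 3 := GaloisImage.surj3_frob_v287775i1 hI
  have hirr : Irr W 3 := hasIrreducibleModPGaloisRep_of_hasSurjectiveModNGaloisRep W 3 hsurj
  have hX : ClassX4 W 3 := ⟨by norm_num, addv_of_intModel hI 3 (by decide) (by decide), hirr⟩
  have hpot : 0 ≤ padicValRat 3 W.j :=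
    padicValRat_j_nonneg_of_intModel hI (p := 3) 1 (by decide) (by decide)
  have htam : ¬ 3 ∣ W.tamagawaProduct :=
    IntModelTam.not_dvd_tamagawaProduct_of_intModel_of_rowCheck hI tamRow_idx_v287775i1 3 (by decide)
  have hE : (⟨1, -1, 0, -9867, -374584⟩ : WeierstrassCurve ℤ).map (Int.castRingHom ℚ) = W := by
    rw [IntModelTam.eq_baseChange_of_integralModelInt hI]; rfl
  have hW : W = ⟨1, -1, 0, -9867, -374584⟩ := by rw [← hE]; ext <;> simp [WeierstrassCurve.map]
  -- θ : E′[3] ≃ E[3] IN THE KERNEL — n1011-p07's Hesse certificate through p07's literal-equation lemma BY NAME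
  obtain ⟨θ, hθ⟩ : X1.CongruenceTransfer.TorsionIso W' W 3 :=
    VisCerts.torsionIso3_of_hesseCert_mk hW hW' 473625 325771875 (-2160) (-437400)
      (by norm_num) (by norm_num) (by norm_num) (by norm_num) (-675) 1 300 (by norm_num)
      (by norm_num) (by norm_num)
  -- `E(ℚ)` finite and `3 ∤ #E(ℚ)` (r_an = 0, `E[3]` irreducible), then the visible element from the kernel instance
  haveI hfin : Finite W.toAffine.Point := finite_point_of_analyticRank_eq_zero W hGZK hr
  have hvis := exists_sha_three_torsion_287775i1 W W' hW hW' θ hθ hfin (coprime_natCard_point_of_irr W 3 hirr)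
  exact X4RankZero.bsdp_of_exists_sha_torsion_of_kato hKato hCT hGZK hmod W 3 hr hX hpot
    (GaloisImage.towerSurj3u_frob_v287775i1 hI) htam D hc hq hv hvis

/-- **T-IDX27-BSDP RECORD (CLOSES NOTHING beyond its displayed binders; moves no mark): `BSD(E,3)` for the PASS-rank3 row
`293184cj1 = [0, 0, 0, -14981484, 22107226192]`** (X4 at `3`, additive potentially multiplicative (`ord₃ j < 0`); `r_an = 0`, `ord₃ #Ш_an = 2`) from its `3`-congruent rank-3 partner
`293184c1 = [0, 0, 0, -252, 1360]` — θ-FREE and RANK-FREE: the visible element is n1011-p17's kernel instance `exists_sha_three_torsion_293184cj1`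
(index certificate `27 ≤ [E′(ℚ):3E′(ℚ)]`, local certificates, D14 at `3`), the `3`-congruence `θ` is DISCHARGED IN THE
KERNEL by n1011-p07's `VisCerts.torsionIso3_of_hesseCert_mk` with the Hesse certificate `(l : m) = (106872 : 1)`, `u = 1259712`
(`certs_all18422.tsv`), `ρ̄_{E,3}` onto by `GaloisImage.surj3_frob_v293184cj1`, `E(ℚ)` finite with `3 ∤ #E(ℚ)` from `r_an = 0`
(`hGZK`) and irreducibility. END = n1011-p14's `X4RankZero.bsdp_three_potMult_of_exists_sha_three_torsion` BY NAME. DISPLAYED = the named facts of the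
END, `hr`, `hq`/`hv` — EVIDENCE columns, not booked. [cite: CremonaMazur2000, §3 and Table 1]
[cite: SilvermanAEC2009, Thm. X.4.2 (a) and X.4.14] [cite: Fisher2012Hessian, Thm. 13.2 (n = 3)] [cite: Cremona2006, Table 1 (labels 293184cj1, 293184c1)] -/
theorem bsdp3_idx_v293184cj1
    (hKatoS : Kato2004.rankZero_padicValNat_sha_le_sub_localTamagawa_of_additive_potGood_of_imageContainsSL2)
    (hDel : Delbourgo1998.prop4_rankZero_pow_dvd_constantCoeff)
    (hGZK : rank_eq_analyticRank_of_analyticRank_le_one) (hmod : hasEntireLFunction_rat)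
    (hmodD : nonempty_modularParametrizationData)
    (hKatoχ : Wuthrich2014.kato_halfEigenCharIdeal_dvd_cyclotomicPrime_of_surjective)
    (hCT : exists_casselsTate_pairing (K := ℚ))
    (W : WeierstrassCurve ℚ) [W.IsElliptic] [W.IsGloballyMinimal]
    (hI : integralModelInt W = ⟨0, 0, 0, -14981484, 22107226192⟩)
    (hr : W.analyticRank = 0) {q : ℚ} (hq : shaAn W = (q : ℂ)) (hv : padicValRat 3 q ≤ 2)
    (W' : WeierstrassCurve ℚ) (hW' : W' = ⟨0, 0, 0, -252, 1360⟩) [W'.IsElliptic] :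
    haveI : Fact (Nat.Prime 3) := ⟨Nat.prime_three⟩
    BSDp W 3 := by
  haveI : Fact (Nat.Prime 3) := ⟨Nat.prime_three⟩
  -- the row: surj(3), X4 at `3`, sign of `ord₃ j`, the literal model
  have hsurj : W.HasSurjectiveModNGaloisRep 3 := GaloisImage.surj3_frob_v293184cj1 hI
  have hirr : Irr W 3 := hasIrreducibleModPGaloisRep_of_hasSurjectiveModNGaloisRep W 3 hsurj
  have hX : ClassX4 W 3 := ⟨by norm_num, addv_of_intModel hI 3 (by decide) (by decide), hirr⟩
  have hj : padicValRat 3 W.j < 0 :=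
    padicValRat_j_neg_of_intModel hI (p := 3) 2 (by decide) (by decide)
  have hE : (⟨0, 0, 0, -14981484, 22107226192⟩ : WeierstrassCurve ℤ).map (Int.castRingHom ℚ) = W := by
    rw [IntModelTam.eq_baseChange_of_integralModelInt hI]; rfl
  have hW : W = ⟨0, 0, 0, -14981484, 22107226192⟩ := by rw [← hE]; ext <;> simp [WeierstrassCurve.map]
  -- θ : E′[3] ≃ E[3] IN THE KERNEL — n1011-p07's Hesse certificate through p07's literal-equation lemma BY NAME
  obtain ⟨θ, hθ⟩ : X1.CongruenceTransfer.TorsionIso W' W 3 :=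
    VisCerts.torsionIso3_of_hesseCert_mk hW hW' 719111232 (-19100643429888) 12096 (-1175040)
      (by norm_num) (by norm_num) (by norm_num) (by norm_num) 106872 1 1259712 (by norm_num)
      (by norm_num) (by norm_num)
  -- `E(ℚ)` finite and `3 ∤ #E(ℚ)` (r_an = 0, `E[3]` irreducible), then the visible element from the kernel instance
  haveI hfin : Finite W.toAffine.Point := finite_point_of_analyticRank_eq_zero W hGZK hr
  have hvis := exists_sha_three_torsion_293184cj1 W W' hW hW' θ hθ hfin (coprime_natCard_point_of_irr W 3 hirr)
  exact X4RankZero.bsdp_three_potMult_of_exists_sha_three_torsion hKatoS hDel hGZK hmod hmodD hKatoχ hCT W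
    hr hX hsurj hj hq hv hvis

/-- E-side Tamagawa ROW certificate of `337896u1 = [0, 0, 0, 102885, 84187366]` (one local certificate per bad prime, Tate's algorithm — n1011-p18's `eside_tamrow` over the observatory's `tate_deep.py`, unchanged;
`2`: additive `III*`, `c = 2` (deep Tate certificate); `3`: additive `I0*`, value SET `[1, 2, 4]` (the `c` slot carries the set's largest member as a placeholder, not an engine value; the bracket theorem reads the set) (deep Tate certificate); `13`: non-split `I1`, `c = 1`; `19`: additive `III*`, `c = 2` (deep Tate certificate)): the certified value set of `∏ c_ℓ` avoids `3`. [cite: SilvermanATAEC1994, IV.9.4] -/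
theorem tamRow_idx_v337896u1 :
    TamLocal.rowCheck [⟨2, 1, 5, 0, 3, 1, 4, 10, 9, 0, 2⟩, ⟨3, 1, 5, 0, 2, 0, 0, 6, 6, 0, 4⟩, ⟨13, 3, 3, 0, 0, 0, 0, 1, 0, 0, 1⟩, ⟨19, 4, 5, 0, 0, 0, 0, 9, 9, 0, 2⟩] ⟨0, 0, 0, 102885, 84187366⟩ = true := by
  decide +kernel

/-- **T-IDX27-BSDP RECORD (CLOSES NOTHING beyond its displayed binders; moves no mark): `BSD(E,3)` for the PASS-rank3 row
`337896u1 = [0, 0, 0, 102885, 84187366]`** (X4 at `3`, additive potentially good (`0 ≤ ord₃ j`; G-ord; `3 ∤ ∏ c_ℓ`); `r_an = 0`, `ord₃ #Ш_an = 2`) from its `3`-congruent rank-3 partner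
`37544c1 = [0, 1, 0, -177, 1171]` — θ-FREE and RANK-FREE: the visible element is n1011-p17's kernel instance `exists_sha_three_torsion_337896u1`
(index certificate `27 ≤ [E′(ℚ):3E′(ℚ)]`, local certificates, D14 at `3`), the `3`-congruence `θ` is DISCHARGED IN THE
KERNEL by n1011-p07's `VisCerts.torsionIso3_of_dualHesseCert_mk` with the Hesse certificate `(l : m) = (2166 : 1)`, `u = 1/608`
(`certs_all18422.tsv`), `ρ̄_{E,3}` onto by `GaloisImage.surj3_frob_v337896u1` and the `3`-adic tower by `GaloisImage.towerSurj3u_frob_v337896u1`, `3 ∤ ∏ c_ℓ` by the Tamagawa row certificate `tamRow_idx_v337896u1`, `E(ℚ)` finite with `3 ∤ #E(ℚ)` from `r_an = 0`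
(`hGZK`) and irreducibility. END = n1011-p14's `X4RankZero.bsdp_of_exists_sha_torsion_of_kato` BY NAME. DISPLAYED = the named facts of the
END, `hr`, `hq`/`hv`, `D`/`hc` (Manin datum) — EVIDENCE columns, not booked. [cite: CremonaMazur2000, §3 and Table 1]
[cite: SilvermanAEC2009, Thm. X.4.2 (a) and X.4.14] [cite: Fisher2012Hessian, Thm. 13.2 (n = 3)] [cite: Cremona2006, Table 1 (labels 337896u1, 37544c1)] -/
theorem bsdp3_idx_v337896u1
    (hKato : Kato2004.rankZero_padicValNat_sha_le_of_additive_potGood_of_imageContainsSL2)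
    (hCT : exists_casselsTate_pairing (K := ℚ))
    (hGZK : rank_eq_analyticRank_of_analyticRank_le_one) (hmod : hasEntireLFunction_rat)
    (W : WeierstrassCurve ℚ) [W.IsElliptic] [W.IsGloballyMinimal]
    (hI : integralModelInt W = ⟨0, 0, 0, 102885, 84187366⟩)
    (hr : W.analyticRank = 0)
    {N : ℕ} [NeZero N] (D : ModularParametrizationData W N) (hc : ¬ ((3 : ℕ) : ℤ) ∣ D.maninConstant)
    {q : ℚ} (hq : shaAn W = (q : ℂ)) (hv : padicValRat 3 q ≤ 2)
    (W' : WeierstrassCurve ℚ) (hW' : W' = ⟨0, 1, 0, -177, 1171⟩) [W'.IsElliptic] :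
    haveI : Fact (Nat.Prime 3) := ⟨Nat.prime_three⟩
    BSDp W 3 := by
  haveI : Fact (Nat.Prime 3) := ⟨Nat.prime_three⟩
  -- the row: surj(3), X4 at `3`, sign of `ord₃ j`, the literal model
  have hsurj : W.HasSurjectiveModNGaloisRep 3 := GaloisImage.surj3_frob_v337896u1 hI
  have hirr : Irr W 3 := hasIrreducibleModPGaloisRep_of_hasSurjectiveModNGaloisRep W 3 hsurj
  have hX : ClassX4 W 3 := ⟨by norm_num, addv_of_intModel hI 3 (by decide) (by decide), hirr⟩
  have hpot : 0 ≤ padicValRat 3 W.j :=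
    padicValRat_j_nonneg_of_intModel hI (p := 3) 2 (by decide) (by decide)
  have htam : ¬ 3 ∣ W.tamagawaProduct :=
    IntModelTam.not_dvd_tamagawaProduct_of_intModel_of_rowCheck hI tamRow_idx_v337896u1 3 (by decide)
  have hE : (⟨0, 0, 0, 102885, 84187366⟩ : WeierstrassCurve ℤ).map (Int.castRingHom ℚ) = W := by
    rw [IntModelTam.eq_baseChange_of_integralModelInt hI]; rfl
  have hW : W = ⟨0, 0, 0, 102885, 84187366⟩ := by rw [← hE]; ext <;> simp [WeierstrassCurve.map]
  -- θ : E′[3] ≃ E[3] IN THE KERNEL — n1011-p07's Hesse certificate through p07's literal-equation lemma BY NAME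
  obtain ⟨θ, hθ⟩ : X1.CongruenceTransfer.TorsionIso W' W 3 :=
    VisCerts.torsionIso3_of_dualHesseCert_mk Fisher2012.thm132rev_threeCongruent_dualHessePencil_holds hW hW' (-4938480) (-72737884224) 8512 (-1062784)
      (by norm_num) (by norm_num) (by norm_num) (by norm_num) 2166 1 (1 / 608) (by norm_num)
      (by norm_num) (by norm_num)
  -- `E(ℚ)` finite and `3 ∤ #E(ℚ)` (r_an = 0, `E[3]` irreducible), then the visible element from the kernel instance
  haveI hfin : Finite W.toAffine.Point := finite_point_of_analyticRank_eq_zero W hGZK hr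
  have hvis := exists_sha_three_torsion_337896u1 W W' hW hW' θ hθ hfin (coprime_natCard_point_of_irr W 3 hirr)
  exact X4RankZero.bsdp_of_exists_sha_torsion_of_kato hKato hCT hGZK hmod W 3 hr hX hpot
    (GaloisImage.towerSurj3u_frob_v337896u1 hI) htam D hc hq hv hvis

/-- **T-IDX27-BSDP RECORD (CLOSES NOTHING beyond its displayed binders; moves no mark): `BSD(E,3)` for the PASS-rank3 row
`409275bk1 = [1, -1, 0, 259083, -69236384]`** (X4 at `3`, additive potentially multiplicative (`ord₃ j < 0`); `r_an = 0`, `ord₃ #Ш_an = 2`) from its `3`-congruent rank-3 partner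
`409275c1 = [0, 0, 1, -6675, -20594]` — θ-FREE and RANK-FREE: the visible element is n1011-p17's kernel instance `exists_sha_three_torsion_409275bk1`
(index certificate `27 ≤ [E′(ℚ):3E′(ℚ)]`, local certificates, D14 at `3`), the `3`-congruence `θ` is DISCHARGED IN THE
KERNEL by n1011-p07's `VisCerts.torsionIso3_of_dualHesseCert_mk` with the Hesse certificate `(l : m) = (-292515 : 13)`, `u = 1/30`
(`certs_all18422.tsv`), `ρ̄_{E,3}` onto by `GaloisImage.surj3_frob_v409275bk1`, `E(ℚ)` finite with `3 ∤ #E(ℚ)` from `r_an = 0`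
(`hGZK`) and irreducibility. END = n1011-p14's `X4RankZero.bsdp_three_potMult_of_exists_sha_three_torsion` BY NAME. DISPLAYED = the named facts of the
END, `hr`, `hq`/`hv` — EVIDENCE columns, not booked. [cite: CremonaMazur2000, §3 and Table 1]
[cite: SilvermanAEC2009, Thm. X.4.2 (a) and X.4.14] [cite: Fisher2012Hessian, Thm. 13.2 (n = 3)] [cite: Cremona2006, Table 1 (labels 409275bk1, 409275c1)] -/
theorem bsdp3_idx_v409275bk1
    (hKatoS : Kato2004.rankZero_padicValNat_sha_le_sub_localTamagawa_of_additive_potGood_of_imageContainsSL2)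
    (hDel : Delbourgo1998.prop4_rankZero_pow_dvd_constantCoeff)
    (hGZK : rank_eq_analyticRank_of_analyticRank_le_one) (hmod : hasEntireLFunction_rat)
    (hmodD : nonempty_modularParametrizationData)
    (hKatoχ : Wuthrich2014.kato_halfEigenCharIdeal_dvd_cyclotomicPrime_of_surjective)
    (hCT : exists_casselsTate_pairing (K := ℚ))
    (W : WeierstrassCurve ℚ) [W.IsElliptic] [W.IsGloballyMinimal]
    (hI : integralModelInt W = ⟨1, -1, 0, 259083, -69236384⟩)
    (hr : W.analyticRank = 0) {q : ℚ} (hq : shaAn W = (q : ℂ)) (hv : padicValRat 3 q ≤ 2)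
    (W' : WeierstrassCurve ℚ) (hW' : W' = ⟨0, 0, 1, -6675, -20594⟩) [W'.IsElliptic] :
    haveI : Fact (Nat.Prime 3) := ⟨Nat.prime_three⟩
    BSDp W 3 := by
  haveI : Fact (Nat.Prime 3) := ⟨Nat.prime_three⟩
  -- the row: surj(3), X4 at `3`, sign of `ord₃ j`, the literal model
  have hsurj : W.HasSurjectiveModNGaloisRep 3 := GaloisImage.surj3_frob_v409275bk1 hI
  have hirr : Irr W 3 := hasIrreducibleModPGaloisRep_of_hasSurjectiveModNGaloisRep W 3 hsurj
  have hX : ClassX4 W 3 := ⟨by norm_num, addv_of_intModel hI 3 (by decide) (by decide), hirr⟩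
  have hj : padicValRat 3 W.j < 0 :=
    padicValRat_j_neg_of_intModel hI (p := 3) 2 (by decide) (by decide)
  have hE : (⟨1, -1, 0, 259083, -69236384⟩ : WeierstrassCurve ℤ).map (Int.castRingHom ℚ) = W := by
    rw [IntModelTam.eq_baseChange_of_integralModelInt hI]; rfl
  have hW : W = ⟨1, -1, 0, 259083, -69236384⟩ := by rw [← hE]; ext <;> simp [WeierstrassCurve.map]
  -- θ : E′[3] ≃ E[3] IN THE KERNEL — n1011-p07's Hesse certificate through p07's literal-equation lemma BY NAME
  obtain ⟨θ, hθ⟩ : X1.CongruenceTransfer.TorsionIso W' W 3 :=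
    VisCerts.torsionIso3_of_dualHesseCert_mk Fisher2012.thm132rev_threeCongruent_dualHessePencil_holds hW hW' (-12435975) 59764273875 320400 17793000
      (by norm_num) (by norm_num) (by norm_num) (by norm_num) (-292515) 13 (1 / 30) (by norm_num)
      (by norm_num) (by norm_num)
  -- `E(ℚ)` finite and `3 ∤ #E(ℚ)` (r_an = 0, `E[3]` irreducible), then the visible element from the kernel instance
  haveI hfin : Finite W.toAffine.Point := finite_point_of_analyticRank_eq_zero W hGZK hr
  have hvis := exists_sha_three_torsion_409275bk1 W W' hW hW' θ hθ hfin (coprime_natCard_point_of_irr W 3 hirr)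
  exact X4RankZero.bsdp_three_potMult_of_exists_sha_three_torsion hKatoS hDel hGZK hmod hmodD hKatoχ hCT W
    hr hX hsurj hj hq hv hvis

/-- E-side KERNEL-EXACT Tamagawa row certificate of `416448db1 = [0, 0, 0, 2292, -85520]` (stage 1 `TamLocal` + stage 2 `TamX` (exact `c` at `IV`/`IV*`) + stage 3 `TamZ`;
n1011-p03's `tamcert.py` over the observatory's engine 1, unchanged; `2`: `In*`, `c = 2`; `3`: `IV`, `c = 1`; `241`: `In`, `c = 1`; `∏ c_ℓ = 2`). [cite: SilvermanATAEC1994, IV.9.4] -/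
theorem rowCheckZ_idx_v416448db1 :
    TamZ.rowCheckZ [⟨2, 1, 5, 0, 446, 0, 0, 26, 72, 7, 2⟩, ⟨3, 1, 4, 0, 2, 0, 0, 5, 4, 2, 1⟩, ⟨241, 15, 3, 0, 0, 0, 0, 1, 0, 0, 1⟩] [⟨3, 1, 2, 2, 0, 0, 5, 0⟩]
      [⟨2, 8, 446, 0, 0, 26, 7, 0⟩] ⟨0, 0, 0, 2292, -85520⟩ = true := by
  decide +kernel

/-- **T-IDX27-BSDP RECORD (CLOSES NOTHING beyond its displayed binders; moves no mark): `BSD(E,3)` for the PASS-rank3 row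
`416448db1 = [0, 0, 0, 2292, -85520]`** (X4 at `3`, additive potentially good (`0 ≤ ord₃ j`; G-ss; `3 ∤ ∏ c_ℓ`); `r_an = 0`, `ord₃ #Ш_an = 2`) from its `3`-congruent rank-3 partner
`416448o1 = [0, 0, 0, -1596, 24496]` — θ-FREE and RANK-FREE: the visible element is n1011-p17's kernel instance `exists_sha_three_torsion_416448db1`
(index certificate `27 ≤ [E′(ℚ):3E′(ℚ)]`, local certificates, D14 at `3`), the `3`-congruence `θ` is DISCHARGED IN THE
KERNEL by n1011-p07's `VisCerts.torsionIso3_of_hesseCert_mk` with the Hesse certificate `(l : m) = (-24 : 1)`, `u = 768`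
(`certs_all18422.tsv`), `ρ̄_{E,3}` onto by `GaloisImage.surj3_frob_v416448db1` and the `3`-adic tower by `GaloisImage.towerSurj3u_frob_v416448db1`, `3 ∤ ∏ c_ℓ` by the Tamagawa row certificate `rowCheckZ_idx_v416448db1`, `E(ℚ)` finite with `3 ∤ #E(ℚ)` from `r_an = 0`
(`hGZK`) and irreducibility. END = n1011-p14's `X4RankZero.bsdp_of_exists_sha_torsion_of_kato` BY NAME. DISPLAYED = the named facts of the
END, `hr`, `hq`/`hv`, `D`/`hc` (Manin datum) — EVIDENCE columns, not booked. [cite: CremonaMazur2000, §3 and Table 1]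
[cite: SilvermanAEC2009, Thm. X.4.2 (a) and X.4.14] [cite: Fisher2012Hessian, Thm. 13.2 (n = 3)] [cite: Cremona2006, Table 1 (labels 416448db1, 416448o1)] -/
theorem bsdp3_idx_v416448db1
    (hKato : Kato2004.rankZero_padicValNat_sha_le_of_additive_potGood_of_imageContainsSL2)
    (hCT : exists_casselsTate_pairing (K := ℚ))
    (hGZK : rank_eq_analyticRank_of_analyticRank_le_one) (hmod : hasEntireLFunction_rat)
    (W : WeierstrassCurve ℚ) [W.IsElliptic] [W.IsGloballyMinimal]
    (hI : integralModelInt W = ⟨0, 0, 0, 2292, -85520⟩)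
    (hr : W.analyticRank = 0)
    {N : ℕ} [NeZero N] (D : ModularParametrizationData W N) (hc : ¬ ((3 : ℕ) : ℤ) ∣ D.maninConstant)
    {q : ℚ} (hq : shaAn W = (q : ℂ)) (hv : padicValRat 3 q ≤ 2)
    (W' : WeierstrassCurve ℚ) (hW' : W' = ⟨0, 0, 0, -1596, 24496⟩) [W'.IsElliptic] :
    haveI : Fact (Nat.Prime 3) := ⟨Nat.prime_three⟩
    BSDp W 3 := by
  haveI : Fact (Nat.Prime 3) := ⟨Nat.prime_three⟩
  -- the row: surj(3), X4 at `3`, sign of `ord₃ j`, the literal model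
  have hsurj : W.HasSurjectiveModNGaloisRep 3 := GaloisImage.surj3_frob_v416448db1 hI
  have hirr : Irr W 3 := hasIrreducibleModPGaloisRep_of_hasSurjectiveModNGaloisRep W 3 hsurj
  have hX : ClassX4 W 3 := ⟨by norm_num, addv_of_intModel hI 3 (by decide) (by decide), hirr⟩
  have hpot : 0 ≤ padicValRat 3 W.j :=
    padicValRat_j_nonneg_of_intModel hI (p := 3) 2 (by decide) (by decide)
  have htam : ¬ 3 ∣ W.tamagawaProduct :=
    IntModelTam.not_dvd_tamagawaProduct_of_intModel_of_rowCheckZ hI rowCheckZ_idx_v416448db1 (by decide +kernel)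
      (p := 3) (by decide +kernel)
  have hE : (⟨0, 0, 0, 2292, -85520⟩ : WeierstrassCurve ℤ).map (Int.castRingHom ℚ) = W := by
    rw [IntModelTam.eq_baseChange_of_integralModelInt hI]; rfl
  have hW : W = ⟨0, 0, 0, 2292, -85520⟩ := by rw [← hE]; ext <;> simp [WeierstrassCurve.map]
  -- θ : E′[3] ≃ E[3] IN THE KERNEL — n1011-p07's Hesse certificate through p07's literal-equation lemma BY NAME
  obtain ⟨θ, hθ⟩ : X1.CongruenceTransfer.TorsionIso W' W 3 :=
    VisCerts.torsionIso3_of_hesseCert_mk hW hW' (-110016) 73889280 76608 (-21164544)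
      (by norm_num) (by norm_num) (by norm_num) (by norm_num) (-24) 1 768 (by norm_num)
      (by norm_num) (by norm_num)
  -- `E(ℚ)` finite and `3 ∤ #E(ℚ)` (r_an = 0, `E[3]` irreducible), then the visible element from the kernel instance
  haveI hfin : Finite W.toAffine.Point := finite_point_of_analyticRank_eq_zero W hGZK hr
  have hvis := exists_sha_three_torsion_416448db1 W W' hW hW' θ hθ hfin (coprime_natCard_point_of_irr W 3 hirr)
  exact X4RankZero.bsdp_of_exists_sha_torsion_of_kato hKato hCT hGZK hmod W 3 hr hX hpot
    (GaloisImage.towerSurj3u_frob_v416448db1 hI) htam D hc hq hv hvis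

end Summit.BirchSwinnertonDyer.Rank1Residual.Additive

end
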